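import Summits.KontsevichZagierPeriods.KontsevichZagierPeriods.Theorems.HurwitzMicroSectorsNormalFormPrincipleDlogMoves
import Summits.KontsevichZagierPeriods.KontsevichZagierPeriods.Theorems.HurwitzMicroSectorsNormalFormPrincipleAlgDlogMoves

/-!
# `NormalFormPrinciple` (stmt-KontsevichZagierPeriods-3869), line `SketchIdeator1` —
# registered sub-goal `ang_add_mem_relations`: the arctangent addition law as ONE rotation move

Siege attempt k2 (variation "explicit / elementary route") for the registered stub
`ang_add_mem_relations` of the crux `NormalFormPrinciple` (route HurwitzMicroSectors, leaf
`stub_boxRigidity`, layer of non-real poles / arctangent carriers). The carriers are the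
representations `RG t d = [(0,t), d/(1+y²)]` of the Kontsevich–Zagier calculus (value `d · arctan t`),
and the stub is the addition theorem of the arctangent read inside `KZ.relations`: for real algebraic
`s, t ≥ 0` with `st < 1` and algebraic `d`,

  `[RG ((t+s)/(1−st)) d] − [RG s d] − [RG t d] ∈ KZ.relations`.

The proof is explicit and elementary — two moves of [Kontsevich–Zagier 2001, §1.2] and nothing else:

* rule (1a) (`PiBox.Dlog.split_mem_relations`, a null point): cut `(0, T)`, `T = (t+s)/(1−st) ≥ t`, at
  `t` into `(0,t)` and `(t,T)`;
* rule (2), ONE change of variables (`moebius_sub_mem_relations`): the Möbius ROTATION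
  `v ↦ (v − t)/(1 + t v)` is a `ℚ`-semialgebraic bijection `(t, T) → (0, s)` with derivative
  `(1+t²)/(1+tv)² > 0`, and the form `d·dv/(1+v²)` is invariant under it
  (`1 + ((v−t)/(1+tv))² = (1+t²)(1+v²)/(1+tv)²`), so `[(t,T), d/(1+y²)] ≡ [(0,s), d/(1+y²)] = RG s d`.

The rule-(2) certificate for one-dimensional representations with an arbitrary integrand is packaged
as `cov_one` (the analogue, for general representations, of `lineRep_cov` of
`Theorems/MzvKernelInKZ/Negative/PiLine.lean`, which is tied to the integrand `1/(1+t²)`).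
The degenerate cases `s = 0` / `t = 0` need no separate treatment (empty slabs, identity rotation).

References: M. Kontsevich, D. Zagier, *Periods* (2001), §1.2 rules (1), (2); J. Bochnak, M. Coste,
M.-F. Roy, *Real Algebraic Geometry* (1998), §2.2 (semialgebraic bookkeeping). No definitions are
introduced (representations are quantified with their domain and integrand).
-/

noncomputable section

open MeasureTheory Set MvPolynomial
open Literature.NumberTheory.Transcendental Literature.NumberTheory.Transcendental.KZ
open Literature.ModelTheory.ExponentialFields (IsSemialgebraic)

namespace Summit.KontsevichZagierPeriods.HurwitzMicroSectors.NormalFormPrinciple.AngAddK2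

open Summit.KontsevichZagierPeriods.HurwitzMicroSectors.NormalFormPrinciple.PiBox.Dlog
  (split_mem_relations isSemialgebraic_setOf_apply_mem_Ioo_of_isAlgebraic)

/-! ## Rule (2) in dimension one, for an arbitrary integrand -/

/-- **One-dimensional change of variables (rule (2)) between arbitrary representations.** For
representations `A`, `B` of dimension one, a function `φ` with `x ↦ φ (x 0)` `ℚ`-semialgebraic on
`A.domain`, differentiable with derivative `φ'` at its points, injective there with image `B.domain`,
and `A.integrand x = B.integrand (φ x) · |φ' x|` on `A.domain`, the difference `[A] − [B]` is ONE
change-of-variables move along `x ↦ (φ (x 0))` (derivative `φ'(x 0) • id`, determinant `φ'(x 0)`).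
[cite: KontsevichZagier2001, §1.2 rule (2)] -/
theorem cov_one (A B : IntegralRep 1) (φ φ' : ℝ → ℝ)
    (hφs : IsSemialgebraicFunOn ℚ A.domain fun x => φ (x 0))
    (hder : ∀ x ∈ A.domain, HasDerivAt φ (φ' (x 0)) (x 0))
    (hinj : ∀ x ∈ A.domain, ∀ y ∈ A.domain, φ (x 0) = φ (y 0) → x 0 = y 0)
    (him : (fun x : Fin 1 → ℝ => (fun _ : Fin 1 => φ (x 0))) '' A.domain = B.domain)
    (hint : ∀ x ∈ A.domain, A.integrand x = B.integrand (fun _ => φ (x 0)) * |φ' (x 0)|) :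
    of A - of B ∈ changeOfVariablesRel := by
  set Φ : (Fin 1 → ℝ) → (Fin 1 → ℝ) := fun x _ => φ (x 0) with hΦ
  set Φ' : (Fin 1 → ℝ) → (Fin 1 → ℝ) →L[ℝ] (Fin 1 → ℝ) := fun x =>
    φ' (x 0) • ContinuousLinearMap.id ℝ (Fin 1 → ℝ) with hΦ'
  have hdet : ∀ x, (Φ' x).det = φ' (x 0) := fun x => by
    simp [hΦ', ContinuousLinearMap.det, LinearMap.det_smul]
  have hΦd : ∀ x ∈ A.domain, HasFDerivWithinAt Φ (Φ' x) A.domain x := by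
    intro x hx
    refine HasFDerivAt.hasFDerivWithinAt ?_
    rw [hasFDerivAt_pi']
    intro i
    have h1 : HasFDerivAt (fun y : Fin 1 → ℝ => φ (y 0))
        (φ' (x 0) • ContinuousLinearMap.proj (R := ℝ) (φ := fun _ : Fin 1 => ℝ) 0) x :=
      (hder x hx).comp_hasFDerivAt x (hasFDerivAt_apply 0 x)
    refine h1.congr_fderiv (ContinuousLinearMap.ext fun w => ?_)
    simp [hΦ', Fin.fin_one_eq_zero i]
  have hΦs : IsSemialgebraicMapOn ℚ A.domain Φ :=
    IsSemialgebraicMapOn.of_forall A.isSemialgebraic_domain fun _ => hφs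
  have hΦi : InjOn Φ A.domain := by
    intro x hx y hy h
    have h0 : φ (x 0) = φ (y 0) := congrFun h 0
    funext i
    rw [Fin.fin_one_eq_zero i]
    exact hinj x hx y hy h0
  exact ⟨1, A, B, Φ, Φ', hΦs, hΦd, hΦi, him.symm, fun x hx => by rw [hint x hx, hdet], rfl⟩

/-! ## The Möbius rotation move for the arctangent carriers -/

/-- **The Möbius rotation move.** For real algebraic `t ≥ 0`, real `s ≥ 0` with `ts < 1` and
`u (1 − ts) = t + s` (so `u = tan(x+y)` for `t = tan x`, `s = tan y`), the rotation
`v ↦ (v − t)/(1 + tv)` is a `ℚ`-semialgebraic bijection `(t, u) → (0, s)` with derivative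
`(1+t²)/(1+tv)² > 0`, and `d/(1+v²)` is invariant: `[(t,u), d/(1+y²)] − [(0,s), d/(1+y²)] ∈ relations`
(one move of rule (2)). [cite: KontsevichZagier2001, §1.2 rule (2)] -/
theorem moebius_sub_mem_relations {t s u d : ℝ} (ht0 : 0 ≤ t) (hts : t * s < 1)
    (hu : u * (1 - t * s) = t + s) (hta : IsAlgebraic ℚ t) (A B : IntegralRep 1)
    (hAd : A.domain = {x | x 0 ∈ Set.Ioo t u}) (hAi : A.integrand = fun x => d / (1 + x 0 ^ 2))
    (hBd : B.domain = {x | x 0 ∈ Set.Ioo 0 s}) (hBi : B.integrand = fun x => d / (1 + x 0 ^ 2)) :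
    of A - of B ∈ relations := by
  have hts' : 0 < 1 - t * s := by linarith
  -- denominators are positive on the source interval
  have hden : ∀ x ∈ A.domain, 0 < 1 + t * x 0 := fun x hx => by
    rw [hAd] at hx
    have : 0 ≤ t * x 0 := mul_nonneg ht0 (ht0.trans hx.1.le)
    linarith
  refine changeOfVariablesRel_subset_relations (cov_one A B
    (fun v => (v - t) / (1 + t * v)) (fun v => (1 + t ^ 2) / (1 + t * v) ^ 2) ?_
    (fun x hx => ?_) (fun x hx y hy h => ?_) ?_ (fun x hx => ?_))
  · -- semialgebraicity (the coefficient `t` is a real algebraic constant)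
    have hS := A.isSemialgebraic_domain
    have hx : IsSemialgebraicFunOn ℚ A.domain fun x => x 0 :=
      (isSemialgebraicFunOn_aeval hS (X 0)).congr fun x _ => by simp
    have hc : IsSemialgebraicFunOn ℚ A.domain fun _ => t :=
      isSemialgebraicFunOn_const_of_isAlgebraic hS hta
    have h1 : IsSemialgebraicFunOn ℚ A.domain fun _ => (1 : ℝ) :=
      (isSemialgebraicFunOn_aeval hS 1).congr fun x _ => by simp
    exact (IsSemialgebraicFunOn.div (IsSemialgebraicFunOn.sub_holds hx hc)
      (IsSemialgebraicFunOn.add_holds h1 (IsSemialgebraicFunOn.mul_holds hc hx))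
      fun x hx => (hden x hx).ne').congr fun x _ => by simp
  · -- derivative
    have h0 := hden x hx
    have hd : HasDerivAt (fun v => (v - t) / (1 + t * v))
        ((1 * (1 + t * x 0) - (x 0 - t) * (t * 1)) / (1 + t * x 0) ^ 2) (x 0) :=
      ((hasDerivAt_id' (x 0)).sub_const t).div (((hasDerivAt_id' (x 0)).const_mul t).const_add 1)
        h0.ne'
    convert hd using 1
    field_simp
    ring
  · -- injectivity
    have hx0 := hden x hx
    have hy0 := hden y hy
    have h' : (x 0 - t) / (1 + t * x 0) = (y 0 - t) / (1 + t * y 0) := h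
    rw [div_eq_div_iff hx0.ne' hy0.ne'] at h'
    have h2 : (x 0 - y 0) * (1 + t ^ 2) = 0 := by linear_combination h'
    rcases mul_eq_zero.mp h2 with h3 | h3
    · exact sub_eq_zero.mp h3
    · exact absurd h3 (by positivity)
  · -- image
    rw [hBd]
    apply Subset.antisymm
    · rintro _ ⟨x, hx, rfl⟩
      have h0 := hden x hx
      rw [hAd] at hx
      obtain ⟨h1, h2⟩ := hx
      refine ⟨?_, ?_⟩
      · show 0 < (x 0 - t) / (1 + t * x 0)
        exact div_pos (by linarith) h0
      · show (x 0 - t) / (1 + t * x 0) < s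
        rw [div_lt_iff₀ h0]
        have hxu : x 0 * (1 - t * s) < u * (1 - t * s) := mul_lt_mul_of_pos_right h2 hts'
        nlinarith [hxu, hu]
    · rintro y ⟨h1, h2⟩
      have htw : 0 < 1 - t * y 0 := by nlinarith [mul_le_mul_of_nonneg_left h2.le ht0]
      refine ⟨fun _ => (y 0 + t) / (1 - t * y 0), ?_, ?_⟩
      · rw [hAd]
        refine ⟨?_, ?_⟩
        · show t < (y 0 + t) / (1 - t * y 0)
          rw [lt_div_iff₀ htw]
          nlinarith [sq_nonneg t, mul_pos h1 (show (0 : ℝ) < 1 + t ^ 2 by positivity)]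
        · show (y 0 + t) / (1 - t * y 0) < u
          rw [div_lt_iff₀ htw]
          have hys : y 0 * (1 + t ^ 2) < s * (1 + t ^ 2) :=
            mul_lt_mul_of_pos_right h2 (by positivity)
          nlinarith [hys, hu, sq_nonneg t]
      · funext i
        rw [Fin.fin_one_eq_zero i]
        show ((y 0 + t) / (1 - t * y 0) - t) / (1 + t * ((y 0 + t) / (1 - t * y 0))) = y 0
        have hne : 1 - t * y 0 ≠ 0 := htw.ne'
        have hd' : 1 + t * ((y 0 + t) / (1 - t * y 0)) = (1 + t ^ 2) / (1 - t * y 0) := by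
          rw [eq_div_iff hne, add_mul, mul_assoc, div_mul_cancel₀ _ hne]
          ring
        have hn' : (y 0 + t) / (1 - t * y 0) - t = y 0 * (1 + t ^ 2) / (1 - t * y 0) := by
          rw [eq_div_iff hne, sub_mul, div_mul_cancel₀ _ hne]
          ring
        rw [hd', hn', div_div_div_cancel_right₀ hne,
          mul_div_cancel_right₀ _ (by positivity : (1 : ℝ) + t ^ 2 ≠ 0)]
  · -- the form `d dv/(1+v²)` is invariant
    have h0 : 1 + t * x 0 ≠ 0 := (hden x hx).ne'
    have h0' : 0 < 1 + t * x 0 := hden x hx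
    rw [hAi, hBi, abs_of_pos (by positivity)]
    simp only
    have key : 1 + ((x 0 - t) / (1 + t * x 0)) ^ 2 =
        (1 + t ^ 2) * (1 + x 0 ^ 2) / (1 + t * x 0) ^ 2 := by
      rw [eq_div_iff (pow_ne_zero 2 h0), add_mul, div_pow, div_mul_cancel₀ _ (pow_ne_zero 2 h0)]
      ring
    have h1 : (1 : ℝ) + t ^ 2 ≠ 0 := by positivity
    have h2 : (1 : ℝ) + x 0 ^ 2 ≠ 0 := by positivity
    rw [key, div_div_eq_mul_div, div_mul_div_comm,
      div_eq_div_iff h2 (mul_ne_zero (mul_ne_zero h1 h2) (pow_ne_zero 2 h0))]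
    ring

/-! ## The stub -/

/-- **Registered sub-goal `ang_add_mem_relations` of crux `NormalFormPrinciple` (stmt-3869), line
`SketchIdeator1`: the addition law of the arctangent carriers inside `KZ.relations`.** For the
carriers `RG t d = [(0,t), d/(1+y²)]` (real algebraic data) and real algebraic `s, t ≥ 0` with
`st < 1`: `[RG ((t+s)/(1−st)) d] − [RG s d] − [RG t d] ∈ KZ.relations` — cut `(0, (t+s)/(1−st))` at
the null point `t` (rule (1a)) and rotate `(t, (t+s)/(1−st))` onto `(0, s)` by `v ↦ (v−t)/(1+tv)`
(rule (2), `d·dv/(1+v²)` invariant). [cite: KontsevichZagier2001, §1.2 rules (1), (2)] -/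
theorem ang_add_mem_relations {RG : ℝ → ℝ → IntegralRep 1}
    (hRG : ∀ t d, IsAlgebraic ℚ t → IsAlgebraic ℚ d →
      (RG t d).domain = {x | x 0 ∈ Set.Ioo 0 t} ∧ (RG t d).integrand = fun x => d / (1 + x 0 ^ 2))
    {s t d : ℝ} (hs : IsAlgebraic ℚ s) (ht : IsAlgebraic ℚ t) (hd : IsAlgebraic ℚ d)
    (hs0 : 0 ≤ s) (ht0 : 0 ≤ t) (hst : s * t < 1) :
    of (RG ((t + s) / (1 - s * t)) d) - of (RG s d) - of (RG t d) ∈ relations := by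
  set T : ℝ := (t + s) / (1 - s * t) with hT
  have hst' : 0 < 1 - s * t := by linarith
  have hTa : IsAlgebraic ℚ T := by
    rw [hT, div_eq_mul_inv]
    exact (ht.add hs).mul (isAlgebraic_one.sub (hs.mul ht)).inv
  have hTu : T * (1 - t * s) = t + s := by
    rw [hT, mul_comm t s, div_mul_cancel₀ _ hst'.ne']
  have htT : t ≤ T := by
    rw [hT, le_div_iff₀ hst']
    nlinarith [mul_nonneg hs0 (sq_nonneg t), mul_nonneg hs0 ht0]
  obtain ⟨hLd, hLi⟩ := hRG T d hTa hd
  obtain ⟨hL₁d, hL₁i⟩ := hRG t d ht hd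
  obtain ⟨hBd, hBi⟩ := hRG s d hs hd
  -- the middle piece `[(t,T), d/(1+y²)]`, a restriction of `RG T d`
  have hPsa : IsSemialgebraic ℚ {x : Fin 1 → ℝ | x 0 ∈ Set.Ioo t T} :=
    isSemialgebraic_setOf_apply_mem_Ioo_of_isAlgebraic ht hTa 0
  have hPsub : {x : Fin 1 → ℝ | x 0 ∈ Set.Ioo t T} ⊆ (RG T d).domain := by
    rw [hLd]
    exact fun x hx => ⟨ht0.trans_lt hx.1, hx.2⟩
  set A : IntegralRep 1 := (RG T d).restrict _ hPsa hPsub with hA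
  -- rule (1a): `[(0,T)] ≡ [(0,t)] + [(t,T)]`
  have hsplit : of (RG T d) - of (RG t d) - of A ∈ relations :=
    split_mem_relations (RG T d) (RG t d) A hLd hL₁d (IntegralRep.domain_restrict _ _ _ _) ht0 htT
      (fun x _ => by rw [hL₁i, hLi]) fun _ _ => rfl
  -- rule (2): `[(t,T)] ≡ [(0,s)]`
  have hrot : of A - of (RG s d) ∈ relations :=
    moebius_sub_mem_relations ht0 (by rwa [mul_comm] at hst) hTu ht A (RG s d)
      (IntegralRep.domain_restrict _ _ _ _) (by rw [hA, IntegralRep.integrand_restrict, hLi]) hBd hBi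
  have e : of (RG T d) - of (RG s d) - of (RG t d) =
      (of (RG T d) - of (RG t d) - of A) + (of A - of (RG s d)) := by abel
  rw [e]
  exact add_mem hsplit hrot

end Summit.KontsevichZagierPeriods.HurwitzMicroSectors.NormalFormPrinciple.AngAddK2

end
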